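import Literature.Geometry.Riemannian.PinchingEstimatesSingularMax
import HarnessLib

/-!
# The Rayleigh minimiser along Hamilton's ODE with the middle eigenvalue kept (Thm. 2.3)
(topic `Geometry/Riemannian`)

Part of the decomposition of `Literature.Geometry.Riemannian.hamilton_chenZhu_pinching`
(`PinchingEstimates.lean`), towards the ODE part of Hamilton 1997, Thm. 2.3 (p. 18:
"`d/dt ln(a₁ + ρ) ≥ 2a₃ + 2b₁ + [(a₁ - b₁)² + 2a₃(a₂ - a₁) - 2ρ(a₃ + b₁)]/(a₁ + ρ)`", from
Hamilton 1986, Lemma 6.1: `d a₁/dt ≥ a₁² + b₁² + 2a₂a₃`). The Thm. 1.9 file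
(`PinchingEstimatesSingularMax.lean`, `exists_diag_basis_of_min`) only kept `a₂a₃ ≥ a₁a₃`;
Thm. 2.3 needs the term `2a₃(a₂ - a₁)`, i.e. the middle eigenvalue itself. PROVED here:

* `exists_diag_basis_of_min'` — as `exists_diag_basis_of_min`, with the first basis vector of
  the complement realising the maximum of the Rayleigh quotient;
* `rayleighMin_package` — for symmetric `A`, a unit minimiser `w` (`a₁ = wᵀAw`) and maximiser
  `u₃` (`a₃`) of the Rayleigh quotient: a unit `e ⊥ w` with `a₁ ≤ eᵀAe = a₂ ≤ a₃` and the EXACT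
  identity `wᵀA'w = a₁² + |ᵗBw|² + 2a₂a₃`, `A' = A² + BᵗB + 2A^#`.

## References

* R. S. Hamilton, Comm. Anal. Geom. 5 (1997), §2.2, Thm. 2.3 (proof, p. 18). [Hamilton1997]
* R. S. Hamilton, J. Differential Geom. 24 (1986), §6, Lemma 6.1 (p. 167). [Hamilton1986]
-/

noncomputable section

open Set Real
open scoped Matrix BigOperators

namespace Literature.Geometry.Riemannian

namespace HamiltonODE

variable {A B : Matrix (Fin 3) (Fin 3) ℝ}

/-- For symmetric `A`, a unit minimiser `w` and a unit maximiser `u₃` of the Rayleigh quotient,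
there is an orthonormal basis `(w, y, y')` diagonalising the form of `A` with `yᵀAy = u₃ᵀAu₃`
(in the generic case `y = u₃ ⊥ w`; if all Rayleigh quotients coincide, any complement works).
[folklore] -/
theorem exists_diag_basis_of_min' (hA : A.IsSymm) {w u₃ : Fin 3 → ℝ} (hw : w ⬝ᵥ w = 1)
    (hu₃ : u₃ ⬝ᵥ u₃ = 1) (hmin : ∀ z ∈ unitSet, w ⬝ᵥ (A *ᵥ w) ≤ z ⬝ᵥ (A *ᵥ z))
    (hmax : ∀ z ∈ unitSet, z ⬝ᵥ (A *ᵥ z) ≤ u₃ ⬝ᵥ (A *ᵥ u₃)) :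
    ∃ y y' : Fin 3 → ℝ, y ⬝ᵥ y = 1 ∧ y' ⬝ᵥ y' = 1 ∧ w ⬝ᵥ y = 0 ∧ w ⬝ᵥ y' = 0 ∧ y ⬝ᵥ y' = 0 ∧
      w ⬝ᵥ (A *ᵥ y) = 0 ∧ w ⬝ᵥ (A *ᵥ y') = 0 ∧ y ⬝ᵥ (A *ᵥ y') = 0 ∧
      y ⬝ᵥ (A *ᵥ y) = u₃ ⬝ᵥ (A *ᵥ u₃) := by
  have hw0 : ∀ z : Fin 3 → ℝ, z ⬝ᵥ w = 0 → w ⬝ᵥ (A *ᵥ z) = 0 :=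
    fun z hz ↦ cross_eq_zero_of_min hA hw hmin hz
  have hu0 : ∀ z : Fin 3 → ℝ, z ⬝ᵥ u₃ = 0 → u₃ ⬝ᵥ (A *ᵥ z) = 0 :=
    fun z hz ↦ cross_eq_zero_of_max hA hu₃ hmax hz
  rcases (hmin u₃ hu₃).eq_or_lt with heq | hlt
  · have hall : ∀ z : Fin 3 → ℝ, z ⬝ᵥ z = 1 → z ⬝ᵥ (A *ᵥ z) = w ⬝ᵥ (A *ᵥ w) :=
      fun z hz ↦ le_antisymm (by rw [heq]; exact hmax z hz) (hmin z hz)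
    have hcross : ∀ e z : Fin 3 → ℝ, e ⬝ᵥ e = 1 → z ⬝ᵥ e = 0 → e ⬝ᵥ (A *ᵥ z) = 0 :=
      fun e z he hz ↦ cross_eq_zero_of_min hA he (fun z' hz' ↦ by rw [hall e he, hall z' hz']) hz
    obtain ⟨y, y', hy, hy', hwy, hwy', hyy'⟩ := exists_orthonormal_complement hw
    refine ⟨y, y', hy, hy', hwy, hwy', hyy', hw0 y (by rw [dotProduct_comm]; exact hwy),
      hw0 y' (by rw [dotProduct_comm]; exact hwy'), hcross y y' hy (by rw [dotProduct_comm]; exact hyy'), ?_⟩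
    rw [hall y hy, hall u₃ hu₃]
  · have huw : u₃ ⬝ᵥ w = 0 := dot_eq_zero_of_eigen hA hu₃ hw hu0 hw0 hlt.ne
    have hwu : w ⬝ᵥ u₃ = 0 := by rw [dotProduct_comm]; exact huw
    set n := w ⨯₃ u₃ with hn
    have hn1 : n ⬝ᵥ n = 1 := dotProduct_cross_self_of_orthonormal hw hu₃ hwu
    have hwn : w ⬝ᵥ n = 0 := dot_self_cross w u₃
    have hun : u₃ ⬝ᵥ n = 0 := dot_cross_self w u₃
    exact ⟨u₃, n, hu₃, hn1, hwu, hwn, hun, hw0 u₃ huw, hw0 n (by rw [dotProduct_comm]; exact hwn),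
      hu0 n (by rw [dotProduct_comm]; exact hun), rfl⟩

/-- **The A-side package at a Rayleigh minimiser, with the middle eigenvalue** (Hamilton 1986,
Lemma 6.1 in exact form: `d a₁/dt = a₁² + |ᵗBw|² + 2a₂a₃` at the minimising eigenvector `w`):
for symmetric `A`, a unit minimiser `w` and a unit maximiser `u₃` of the Rayleigh quotient
there is a unit `e ⊥ w` with `wᵀAw ≤ eᵀAe ≤ u₃ᵀAu₃` and
`wᵀ(A² + BᵗB + 2A^#)w = (wᵀAw)² + |ᵗBw|² + 2 (eᵀAe)(u₃ᵀAu₃)`.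
[cite: Hamilton1997, §2.2, Thm. 2.3 (proof, p. 18)] -/
theorem rayleighMin_package (hA : A.IsSymm) {w u₃ : Fin 3 → ℝ} (hw : w ⬝ᵥ w = 1)
    (hu₃ : u₃ ⬝ᵥ u₃ = 1) (hmin : ∀ z ∈ unitSet, w ⬝ᵥ (A *ᵥ w) ≤ z ⬝ᵥ (A *ᵥ z))
    (hmax : ∀ z ∈ unitSet, z ⬝ᵥ (A *ᵥ z) ≤ u₃ ⬝ᵥ (A *ᵥ u₃)) :
    ∃ e : Fin 3 → ℝ, e ⬝ᵥ e = 1 ∧ w ⬝ᵥ e = 0 ∧ w ⬝ᵥ (A *ᵥ w) ≤ e ⬝ᵥ (A *ᵥ e) ∧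
      e ⬝ᵥ (A *ᵥ e) ≤ u₃ ⬝ᵥ (A *ᵥ u₃) ∧
      w ⬝ᵥ ((A * A + B * Bᵀ + (2 : ℝ) • A.sharp) *ᵥ w) =
        (w ⬝ᵥ (A *ᵥ w)) ^ 2 + (Bᵀ *ᵥ w) ⬝ᵥ (Bᵀ *ᵥ w) +
          2 * ((e ⬝ᵥ (A *ᵥ e)) * (u₃ ⬝ᵥ (A *ᵥ u₃))) := by
  obtain ⟨y, y', hy, hy', hwy, hwy', hyy', cwy, cwy', cyy', hya₃⟩ :=
    exists_diag_basis_of_min' hA hw hu₃ hmin hmax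
  -- `(y, y', w)` is an orthonormal basis diagonalising the form
  have cyw : y ⬝ᵥ (A *ᵥ w) = 0 := by rw [quad_comm_of_isSymm hA]; exact cwy
  have cy'w : y' ⬝ᵥ (A *ᵥ w) = 0 := by rw [quad_comm_of_isSymm hA]; exact cwy'
  have h := quad_field_eq_of_diag (N := B) hA hy hy' hw hyy' (by rw [dotProduct_comm]; exact hwy)
    (by rw [dotProduct_comm]; exact hwy') cyy' cyw cy'w
  refine ⟨y', hy', hwy', hmin y' hy', hmax y' hy', ?_⟩
  rw [h, hya₃]
  ring

end HamiltonODE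

end Literature.Geometry.Riemannian

end
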